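import Literature.NumberTheory.Rogawski1990.Ch4Sec10                       -- ★ p847897: `IsEpsConj`, `epsCentralizer`, `epsNorm`, `unitaryTwist` (TR-t01)
import Literature.NumberTheory.Rogawski1990.SplitPlaceTwistedTransfer       -- ★ (TR-t02): `SplitPlace.eps`, `normElt`, `normFirst`, `IsEpsConj`
import HarnessLib

/-!
# BRIDGE NOTE (theorems only): the abstract twisted layer of ★ `Ch4Sec10` (§4.10, any `ε : G̃ →* G̃`) SPECIALISES to the tree's two concrete twisted
# vocabulary — TR-t02's split-place `G̃_v = GL_n × GL_n` (★ `SplitPlaceTwistedTransfer`, §4.13); Arthur–Clozel's entrywise Galois twist on `GL_n(E)`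
# (★ `ArthurClozelNormMap`) recorded — and its unitary twist has fixed subgroup ★ `unitaryGroup σ Φ`

Topic `NumberTheory/Rogawski1990`; namespace `Literature.NumberTheory.Rogawski1990.Ch4Sec10`.  THEOREMS ONLY (kernel lane): no definition, no named fact, no
`sorry`, no instance, no notation; squad TR bridge-note protocol (TR-plan 02:05:06Z: «bridge notes between parallel data … as a THEOREM-ONLY file (kernel lane,
`--kind proof`) proving the dictionaries inter-define, never by editing a landed statement file»).  Seat TR-t01.
* `mem_epsCentralizer_iff`, `mem_epsCentralizer_iff'` — `g ∈ G̃_{δε} ↔ g δ ε(g)⁻¹ = δ ↔ g⁻¹ δ ε(g) = δ` (the two printed spellings, [Rogawski1990, §1.4 p. 4]).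
* `SplitPlace.normElt_eq_epsNorm`, `SplitPlace.normFirst_eq_fst_epsNorm`, `SplitPlace.isEpsConj_iff_isEpsConj` — t02's §4.13 norm ∕ ε-conjugacy on `GL_n × GL_n` are
  the §1 layer at `ε = SplitPlace.eps Φ` [Rogawski1990, §4.13 p. 64; §3.10 p. 33].
* (not imported, recorded for the merge desks) Arthur–Clozel's entrywise twist on `GL_n(E)` is the §1 layer at `ε = ArthurClozel.galAct σ`:
  `ArthurClozel.IsSigmaConj σ g h ↔ IsEpsConj (galAct σ) h g` (by `isEpsConj_iff_exists_inv`), `ArthurClozel.sigmaCentralizer σ x = epsCentralizer (galAct σ) x`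
  (by `mem_epsCentralizer_iff'` and ★ `ArthurClozel.mem_sigmaCentralizer_iff`), `ArthurClozel.normMap σ 2 x = epsNorm (galAct σ) x` (by ★ `normMap_succ`,
  `normMap_one`) [ArthurClozelAMS120, Ch. 1 §1].
* `coe_unitaryTwist`, `unitaryTwist_eq_self_iff_mem_unitaryGroup` — `ε(g) = Φ⁻¹((σg)ᵀ)⁻¹Φ` as a matrix, and **`ε(g) = g ↔ g ∈ unitaryGroup σ Φ`**: the unitary group
  in the tree's convention `{(σg)ᵀ Φ g = Φ}` IS the fixed subgroup of the unitary twist («`i : G → G̃` is an isomorphism of `G` with the subgroup of `G̃` fixed by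
  `ε`», [Rogawski1990, §3.10 p. 33]).
HONEST LABEL: HC_CM is proved only modulo the 7 printed citations (2 remaining: hLiu418 = stmt-HodgeConjecture-24832, h413 = stmt-HodgeConjecture-24833) until rung 0
closes; this note discharges none of them.

## References
* [Rogawski1990] J. D. Rogawski, *Automorphic Representations of Unitary Groups in Three Variables*, Ann. of Math. Stud. 123 (1990): §1.4 p. 4, §3.10 p. 33,
  §4.10 p. 57, §4.13 p. 64.
* [ArthurClozelAMS120] J. Arthur, L. Clozel, *Simple algebras, base change, and the advanced theory of the trace formula*, Ann. of Math. Stud. 120 (1989), Ch. 1 §1.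
-/

noncomputable section

open scoped MatrixGroups

namespace Literature.NumberTheory.Rogawski1990.Ch4Sec10

open Literature.NumberTheory.Rogawski1990 Literature.NumberTheory.Automorphic
open Literature.NumberTheory.GaloisRepresentations (glTransposeInv)
open Literature.AlgebraicGeometry.ShimuraVarieties (unitaryGroup)

/-! ## The ε-centralizer: the two printed spellings -/

section Abstract

variable {Gt : Type*} [Group Gt] (ε : Gt →* Gt)

/-- `g ∈ G̃_{δε} ↔ g δ ε(g)⁻¹ = δ`. [cite: Rogawski1990, §1.4 p. 4] -/
theorem mem_epsCentralizer_iff (δ g : Gt) : g ∈ epsCentralizer ε δ ↔ g * δ * (ε g)⁻¹ = δ := by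
  change δ⁻¹ * g * δ⁻¹⁻¹ = ε g ↔ _
  rw [inv_inv]
  constructor
  · intro h
    rw [← h]
    group
  · intro h
    calc δ⁻¹ * g * δ = δ⁻¹ * (g * δ * (ε g)⁻¹) * ε g := by group
      _ = ε g := by rw [h, inv_mul_cancel, one_mul]

/-- `g ∈ G̃_{δε} ↔ g⁻¹ δ ε(g) = δ` (print's spelling «`{g : g⁻¹γε(g) = γ}`»). [cite: Rogawski1990, §1.4 p. 4] -/
theorem mem_epsCentralizer_iff' (δ g : Gt) : g ∈ epsCentralizer ε δ ↔ g⁻¹ * δ * ε g = δ := by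
  rw [mem_epsCentralizer_iff]
  constructor
  · intro h
    calc g⁻¹ * δ * ε g = g⁻¹ * (g * δ * (ε g)⁻¹) * ε g := by rw [h]
      _ = δ := by group
  · intro h
    calc g * δ * (ε g)⁻¹ = g * (g⁻¹ * δ * ε g) * (ε g)⁻¹ := by rw [h]
      _ = δ := by group

/-- `IsEpsConj` in print's spelling: `δ′ = x⁻¹ δ ε(x)` for some `x`. [cite: Rogawski1990, §1.4 p. 4] -/
theorem isEpsConj_iff_exists_inv (δ δ' : Gt) : IsEpsConj ε δ δ' ↔ ∃ x : Gt, δ' = x⁻¹ * δ * ε x := by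
  constructor
  · rintro ⟨y, hy⟩
    exact ⟨y⁻¹, by rw [inv_inv, map_inv, hy]⟩
  · rintro ⟨x, hx⟩
    exact ⟨x⁻¹, by rw [map_inv, inv_inv, hx]⟩

end Abstract

/-! ## TR-t02's split-place vocabulary (§4.13) is the §1 layer at `ε = SplitPlace.eps Φ` -/

section SplitPlace

variable {F : Type*} [CommRing F] [TopologicalSpace F] {n : ℕ} (Φ : GL (Fin n) F)

/-- `N(δ) = δ ε(δ)` on `G̃_v = GL_n × GL_n`: t02's `SplitPlace.normElt` is `epsNorm (SplitPlace.eps Φ)` (definitionally). [cite: Rogawski1990, §4.13 p. 64; §3.10 p. 33] -/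
theorem SplitPlace.normElt_eq_epsNorm (δ : GL (Fin n) F × GL (Fin n) F) :
    SplitPlace.normElt Φ δ = epsNorm (SplitPlace.eps Φ) δ := rfl

/-- `N(δ)` read in the first factor: `SplitPlace.normFirst Φ δ = (epsNorm (SplitPlace.eps Φ) δ).1`. [cite: Rogawski1990, §4.13 p. 66; §3.10 p. 33] -/
theorem SplitPlace.normFirst_eq_fst_epsNorm (δ : GL (Fin n) F × GL (Fin n) F) :
    SplitPlace.normFirst Φ δ = (epsNorm (SplitPlace.eps Φ) δ).1 := rfl

/-- t02's ε-conjugacy on `G̃_v` is `IsEpsConj (SplitPlace.eps Φ)`. [cite: Rogawski1990, §3.10 p. 33; §4.13 p. 66] -/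
theorem SplitPlace.isEpsConj_iff_isEpsConj (δ δ' : GL (Fin n) F × GL (Fin n) F) :
    SplitPlace.IsEpsConj Φ δ δ' ↔ IsEpsConj (SplitPlace.eps Φ) δ δ' := by
  rw [isEpsConj_iff_exists_inv]
  rfl

end SplitPlace

/-! ## The unitary twist: matrix form and fixed subgroup -/

section Unitary

variable {R : Type*} [CommRing R] [TopologicalSpace R] {n : Type*} [Fintype n] [DecidableEq n] (σ : R →+* R) (Φ : GL n R)

/-- `ε(g)` as a matrix: `Φ⁻¹ · ((σg)⁻¹)ᵀ · Φ` (with `(σg)⁻¹` the inverse in `GL_n(R)` of the entrywise image). [cite: Rogawski1990, §3.10 p. 33] -/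
theorem coe_unitaryTwist (g : GL n R) :
    ((unitaryTwist σ Φ g : GL n R) : Matrix n n R) =
      ((Φ⁻¹ : GL n R) : Matrix n n R) * (((Matrix.GeneralLinearGroup.map σ g)⁻¹ : GL n R) : Matrix n n R).transpose * (Φ : Matrix n n R) := rfl

/-- The inverse of `ε(g)`'s middle factor: `(glTransposeInv g)⁻¹ = gᵀ` as a matrix (plumbing for the next theorem). [folklore] -/
private theorem coe_glTransposeInv_inv (g : GL n R) :
    (((glTransposeInv n R g)⁻¹ : GL n R) : Matrix n n R) = ((g : GL n R) : Matrix n n R).transpose := rfl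

/-- **The unitary group is the fixed subgroup of the unitary twist**: `ε(g) = g ↔ g ∈ unitaryGroup σ Φ` (`(σg)ᵀ Φ g = Φ`, the tree's convention).
[cite: Rogawski1990, §3.10 p. 33; §1.9 p. 8] -/
theorem unitaryTwist_eq_self_iff_mem_unitaryGroup (g : GL n R) :
    unitaryTwist σ Φ g = g ↔ g ∈ unitaryGroup σ (Φ : Matrix n n R) := by
  rw [Literature.AlgebraicGeometry.ShimuraVarieties.mem_unitaryGroup_iff]
  have h2 : ∀ T : GL n R, (Φ⁻¹ * T * Φ = g ↔ Φ = T⁻¹ * Φ * g) := fun T => by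
    constructor
    · intro h
      calc Φ = T⁻¹ * Φ * (Φ⁻¹ * T * Φ) := by group
        _ = T⁻¹ * Φ * g := by rw [h]
    · intro h
      calc Φ⁻¹ * T * Φ = Φ⁻¹ * T * (T⁻¹ * Φ * g) := by rw [← h]
        _ = g := by group
  rw [show unitaryTwist σ Φ g = Φ⁻¹ * glTransposeInv n R (Matrix.GeneralLinearGroup.map σ g) * Φ from rfl, h2, Units.ext_iff,
    Units.val_mul, Units.val_mul, coe_glTransposeInv_inv, eq_comm]
  exact Iff.rfl

end Unitary

end Literature.NumberTheory.Rogawski1990.Ch4Sec10
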